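import Summits.BirchSwinnertonDyer.BirchSwinnertonDyer.Theses.TwoAdicConverse
import Summits.BirchSwinnertonDyer.Rank1Residual.X5.TwoAdicTargetsEisenstein
import Summits.BirchSwinnertonDyer.Rank1Residual.X5.TwoAdicTargetsClosedFormConverse
import Literature.NumberTheory.EllipticCurves.BSDSelmerCMPConverseProofs
import HarnessLib

/-!
# Route `TwoAdicConverse` (rung S3), crux `GoodOrdinaryRankZeroTwoConverse`: the Theorems-side BRIDGE
# — the rank-`0` `2`-converse at a good ordinary `2` needs ONLY the Eisenstein half of the `2`-adic
# main conjecture (seat `bsd-2adic-ord`)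

HONEST FRAMING (cell `bsd-2adic`, run/shared/lean/pub/bsd-2adic/, HUMAN RULINGS D-0036/D-0059):
THEOREMS ONLY; nothing asserted, no definition, no named fact introduced. The crux
`Summit.BirchSwinnertonDyer.BirchSwinnertonDyer.Theses.TwoAdicConverse.GoodOrdinaryRankZeroTwoConverse`
(for every non-CM `E/ℚ` good ordinary at `2`: `corank_{ℤ₂} Sel_{2^∞}(E/ℚ) = 0 ⇒ r_an(E) = 0`) is OPEN.
This file records, kernel-checked, which ∀-closed statements imply it:

* PRINT (named facts as hypotheses): modularity (`nonempty_modularParametrizationData`), Kato 2004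
  Thm. 17.4 (1) AT `2` (`kato_divisibility_allPrimes W 2`, used ONLY for "`X(E/ℚ_∞)` is `Λ`-torsion",
  parity-free in print); Greenberg 1999 Thm. 4.1 read at `p = 2`, control slot `δ = 0`, typed
  Summits-side as `X5.O1.TwoAdicEulerCharRankZero W 0` (it packages Mazur's control theorem and the
  Euler-characteristic formula: `f_X(0)·#E(ℚ)(2)² = u·2^{ord₂∏c}·#Ẽ(𝔽₂)(2)²·#Sel_{2^∞}(E/ℚ)`);
* OPEN: the EISENSTEIN half `X5.O1.MainConjectureEisensteinDivisibilityAtTwo W` of the `2`-adic main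
  conjecture (`ι f_X = ι h · ϖ·L₂(f,α)`: Skinner–Urban's direction, printed for odd `p` only).

The KATO half (and hence the `μ`-part at `2`, `X5.O1.KatoMuPartAtTwo`) is NOT needed for the converse:
`Sel` finite ⇒ `f_X(0) ≠ 0` (Greenberg 4.1@2) ⇒ `L₂(f,α)(0) ≠ 0` (Eisenstein half) ⇒ `[0]⁺_f ≠ 0`
(interpolation `L₂(f,α)(0) = (1 − α⁻¹)²·[0]⁺_f`) ⇒ `L(E,1) = [0]⁺_f·Ω⁺_f ≠ 0`. This is the classical
shape of the rank-`0` `p`-converse (Greenberg LNM 1716 §1 pp. 65–66; Skinner–Urban Thm. 3.6.11),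
read at `p = 2` with every printed input displayed. TWIN (D-0056): the formula twin is
`Theorems/ByReductionTypeAtTwoGoodOrdinaryInputs.lean` (same PRINT + both halves).

PARTITION (D-0054): none — RANK axis (S3); companion formula cell X5@2 good-ord (B1·O1; 611 book230
classes), object `X5.O1.MainConjectureEisensteinDivisibilityAtTwo`, owner bsd-2adic.

References: [GreenbergLNM1716] Thm. 4.1 (p. 102), §1 (pp. 65–66); [SkinnerUrban2014] Thm. 3.6.11,
Conj. 3.6.8 (p odd); [MazurTateTeitelbaum1986Invent] §I.14 (14.3); [Kato2004Asterisque] Thm. 17.4 (1).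
-/

set_option autoImplicit false

noncomputable section

open scoped Classical MatrixGroups ModularForm

open CongruenceSubgroup WeierstrassCurve Literature.NumberTheory.EllipticCurves
  Literature.NumberTheory.EllipticCurves.ModularForms
  Literature.NumberTheory.EllipticCurves.Rank1Residual
  Literature.NumberTheory.EllipticCurves.Rank1Residual.Typed
  Summit.BirchSwinnertonDyer.BirchSwinnertonDyer.Theorems.Rank1ResidualX1Defs
  Summit.BirchSwinnertonDyer.Rank1Residual.X5

namespace Summit.BirchSwinnertonDyer.BirchSwinnertonDyer.Theorems

open Summit.BirchSwinnertonDyer.BirchSwinnertonDyer.Theses.TwoAdicConverse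

/-- **`L(E,1) ≠ 0` from a finite `2^∞`-Selmer group at a good ordinary `2`, modulo PRINT and the
Eisenstein half.** For `W` globally minimal, good ordinary at `2`: if `X(E/ℚ_∞)` is `Λ`-torsion for the
cyclotomic data (`hX`; Kato 17.4 (1) at `2`), Greenberg's Thm. 4.1 at `2` holds with `δ = 0` (`hEC`),
the Eisenstein half holds (`hE`) and `Sel_{2^∞}(E/ℚ)` is finite, then `L(E,1) ≠ 0`. Proof: pick the
newform `f` (modularity), the Néron ratio `ϖ > 0`, a cyclotomic datum and a dual datum `D` with
`char_Λ X = (f_X)`; Thm. 4.1 gives `f_X(0) ≠ 0`; the Eisenstein half `ι f_X = ι h·ϖ·L₂(f,α)` gives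
`L₂(f,α)(0) ≠ 0`; interpolation gives `[0]⁺_f ≠ 0`; `L(E,1) = [0]⁺_f·Ω⁺_f`, `Ω⁺_f > 0`.
[cite: GreenbergLNM1716, Thm. 4.1 (p. 102) and §1 (pp. 65–66)]
[cite: MazurTateTeitelbaum1986Invent, §I.14 (14.3)] [cite: SkinnerUrban2014, Thm. 3.6.11 (shape; p odd)] -/
theorem entireLFunction_one_ne_zero_of_finite_selmer_of_eisensteinAtTwo
    (W : WeierstrassCurve ℚ) [W.IsElliptic] [W.IsGloballyMinimal]
    (hmod : nonempty_modularParametrizationData)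
    (hX : ∀ (κ : ZpExtension ℚ 2) (γ : Field.absoluteGaloisGroup ℚ), κ.IsCyclotomic →
      κ.IsTopGenerator γ → IsCyclotomicVariable 2 γ → ∀ D : W.SelmerDualData κ γ, D.IsTorsion)
    (hEC : O1.TwoAdicEulerCharRankZero W 0) (hgo : GoodOrd W 2)
    (hE : O1.MainConjectureEisensteinDivisibilityAtTwo W)
    (hSel : Finite (W.selmerGroupPInfty 2)) : W.entireLFunction 1 ≠ 0 := by
  have hord : IsOrdinaryAt W 2 := hgo
  haveI : NeZero (W.conductorNorm ℤ) := ⟨(W.conductorNorm_pos_holds).ne'⟩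
  obtain ⟨Dm⟩ := hmod W
  have hf : IsNewformOf W Dm.f := Dm.isNewformOf
  obtain ⟨ϖ, hϖpos, hϖ, -⟩ := Dm.exists_rat_mul_realPeriodRat_eq_plusPeriod
  obtain ⟨κ, hκ, γ, hγ, hγ'⟩ := exists_isCyclotomic_isTopGenerator_isCyclotomicVariable_holds 2
  obtain ⟨D⟩ := W.nonempty_selmerDualData_holds κ γ hγ
  haveI : Module.Finite (IwasawaAlgebra 2) D.X := D.module_finite_holds hγ
  obtain ⟨fE, hfE⟩ := (charIdeal_isPrincipal_holds 2 D.X).principal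
  have hchar : D.charIdeal = Ideal.span {fE} := hfE
  -- the Eisenstein half: `ι f_X = ι h · (ϖ · L₂(f,α))`
  obtain ⟨h, hh⟩ := hE κ γ hκ hγ hγ' hord Dm.f hf ϖ hϖ D fE hchar
  -- Greenberg Thm. 4.1 AT `2` for the generator `f_X`
  haveI := hSel
  obtain ⟨u, hu⟩ := hEC hord κ γ hκ hγ hγ' D (hX κ γ hκ hγ hγ' D) fE hchar hSel
  rw [add_zero, zpow_natCast] at hu
  have h20 : (2 : ℚ_[2]) ≠ 0 := two_ne_zero
  have hNp0 : (Nat.card (AddCommGroup.primaryComponent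
      ((integralModelInt W).map (Int.castRingHom (ZMod 2))).toAffine.Point 2) : ℚ_[2]) ≠ 0 := by
    exact_mod_cast Nat.card_pos.ne'
  have hS0 : (Nat.card (W.selmerGroupPInfty 2) : ℚ_[2]) ≠ 0 := by exact_mod_cast Nat.card_pos.ne'
  have hfE0 : ((PowerSeries.constantCoeff fE : ℤ_[2]) : ℚ_[2]) ≠ 0 := by
    intro h0
    rw [h0, zero_mul] at hu
    exact (mul_ne_zero (mul_ne_zero (mul_ne_zero (coe_units_ne_zero 2 u)
      (pow_ne_zero _ h20)) (pow_ne_zero 2 hNp0)) hS0) hu.symm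
  -- constant coefficients: `f_X(0) = h(0) · ϖ · (1 - α⁻¹)² · [0]⁺_f`
  have hι0 : ((PowerSeries.constantCoeff fE : ℤ_[2]) : ℚ_[2]) =
      ((PowerSeries.constantCoeff h : ℤ_[2]) : ℚ_[2]) *
        ((ϖ : ℚ_[2]) * ((1 - ((unitRoot W 2 : ℤ_[2]) : ℚ_[2])⁻¹) ^ 2 *
          (ratPlusSymbol Dm.f 0 : ℚ_[2]))) := by
    rw [← constantCoeff_iwasawaToPowerSeries 2 fE, hh, map_mul, map_mul,
      constantCoeff_iwasawaToPowerSeries 2 h, PowerSeries.constantCoeff_C,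
      constantCoeff_padicLFunction_unitRoot hord hf]
  have hs0 : ratPlusSymbol Dm.f 0 ≠ 0 := by
    intro hs
    apply hfE0
    rw [hι0, hs, Rat.cast_zero, mul_zero, mul_zero, mul_zero]
  -- `L(E,1) = [0]⁺_f · Ω⁺_f`, `Ω⁺_f > 0`
  have hper : 0 < plusPeriod Dm.f := IsNewform0.plusPeriod_pos_holds hf.1 hf.coeffField_eq_bot
  rw [hf.entireLFunction_one_eq]
  have hre : ((ratPlusSymbol Dm.f 0 : ℚ) : ℝ) * plusPeriod Dm.f ≠ 0 :=
    mul_ne_zero (by exact_mod_cast hs0) hper.ne'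
  exact_mod_cast hre

/-- **BRIDGE — the crux `GoodOrdinaryRankZeroTwoConverse` from PRINT and the Eisenstein half,
∀-closed over the class.** PRINT: modularity (`hmod`), Kato 17.4 (1)(2) AT `2` (`h17`; only clause
(1), `X` torsion, is used), Greenberg Thm. 4.1 AT `2` with `δ = 0` on every non-CM good-ordinary-at-`2`
curve (`hEC`). OPEN: the Eisenstein half `X5.O1.MainConjectureEisensteinDivisibilityAtTwo W` on every
non-CM good-ordinary-at-`2` curve (`hE`). Then `corank_{ℤ₂} Sel_{2^∞}(E/ℚ) = 0 ⇒ r_an(E) = 0`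
(`finite_selmerGroupPInfty_iff_selmerCorank_eq_zero` + the theorem above +
`analyticRank_eq_zero_of_entireLFunction_one_ne_zero`). The Kato half / `μ`-part is not an input.
[cite: GreenbergLNM1716, Thm. 4.1 (p. 102)] [cite: Kato2004Asterisque, Thm. 17.4 (1) (p. 273)]
[cite: SkinnerUrban2014, Thm. 3.6.11 (shape; p odd)] -/
theorem goodOrdinaryRankZeroTwoConverse_of_inputs
    (hmod : nonempty_modularParametrizationData)
    (h17 : ∀ (W : WeierstrassCurve ℚ) [W.IsElliptic] [W.IsGloballyMinimal]
      [NeZero (W.conductorNorm ℤ)] (f : CuspForm (Gamma0 (W.conductorNorm ℤ)) 2),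
      kato_divisibility_allPrimes W 2 (f := f))
    (hEC : ∀ (W : WeierstrassCurve ℚ) [W.IsElliptic] [W.IsGloballyMinimal],
      ¬ W.HasCM → GoodOrd W 2 → O1.TwoAdicEulerCharRankZero W 0)
    (hE : ∀ (W : WeierstrassCurve ℚ) [W.IsElliptic] [W.IsGloballyMinimal],
      ¬ W.HasCM → GoodOrd W 2 → O1.MainConjectureEisensteinDivisibilityAtTwo W) :
    GoodOrdinaryRankZeroTwoConverse := by
  unfold GoodOrdinaryRankZeroTwoConverse
  intro W _ _ hcm hgo hsel
  have hord : IsOrdinaryAt W 2 := hgo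
  haveI : NeZero (W.conductorNorm ℤ) := ⟨(W.conductorNorm_pos_holds).ne'⟩
  obtain ⟨Dm⟩ := hmod W
  have hSel : Finite (W.selmerGroupPInfty 2) :=
    (finite_selmerGroupPInfty_iff_selmerCorank_eq_zero W 2).2 hsel
  exact analyticRank_eq_zero_of_entireLFunction_one_ne_zero W
    (entireLFunction_one_ne_zero_of_finite_selmer_of_eisensteinAtTwo W hmod
      (fun κ γ hκ hγ hγ' D => (h17 W Dm.f κ γ hκ hγ hγ' hord Dm.isNewformOf D).1)
      (hEC W hcm hgo) hgo (hE W hcm hgo) hSel)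

/-- **One-child form: the `2`-adic main conjecture on the class gives the converse** (the main
conjecture implies the Eisenstein half, `X5.O1.mainConjectureEisensteinDivisibilityAtTwo_of_mazurMainConjecture`).
Same PRINT as `goodOrdinaryRankZeroTwoConverse_of_inputs`. [cite: GreenbergLNM1716, Thm. 4.1 (p. 102)]
[cite: CastellaGrossiSkinner2025, Introduction (MC) (shape)] -/
theorem goodOrdinaryRankZeroTwoConverse_of_mazurMainConjecture
    (hmod : nonempty_modularParametrizationData)
    (h17 : ∀ (W : WeierstrassCurve ℚ) [W.IsElliptic] [W.IsGloballyMinimal]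
      [NeZero (W.conductorNorm ℤ)] (f : CuspForm (Gamma0 (W.conductorNorm ℤ)) 2),
      kato_divisibility_allPrimes W 2 (f := f))
    (hEC : ∀ (W : WeierstrassCurve ℚ) [W.IsElliptic] [W.IsGloballyMinimal],
      ¬ W.HasCM → GoodOrd W 2 → O1.TwoAdicEulerCharRankZero W 0)
    (hMC : ∀ (W : WeierstrassCurve ℚ) [W.IsElliptic] [W.IsGloballyMinimal],
      ¬ W.HasCM → GoodOrd W 2 → MazurMainConjecture W 2) :
    GoodOrdinaryRankZeroTwoConverse :=
  goodOrdinaryRankZeroTwoConverse_of_inputs hmod h17 hEC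
    (fun W _ _ hcm hgo =>
      O1.mainConjectureEisensteinDivisibilityAtTwo_of_mazurMainConjecture W (fun _ => hMC W hcm hgo))

end Summit.BirchSwinnertonDyer.BirchSwinnertonDyer.Theorems

end
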